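import Summits.MatrixMultiplication.MatrixMultiplication.Theorems.ObstructionDescentUniversalOccurrenceTwoRectangleTwoRowArith

set_option linter.dupNamespace false
set_option autoImplicit false

/-!
# Universal occurrence — two rectangles, ALL TWO-ROW TYPES, part N: the value of a term of the `k`-pair design (decomp-mm · lens 3 · gen 43)

Route `route-MatrixMultiplication-ObstructionDescent` (sub-problem `MatrixMultiplication`, `ω(ℂ) = 2`); SUPPORT for the crux
`NoOccurrenceObstruction` (`P_O`, item `stmt-MatrixMultiplication-29040`) through the universal-occurrence programme (NODE-g29…g43
of the decomp-mm cell, lens 3).  Nothing here proves `ω = 2` or closes an item; no `def`, no `sorry`, standard axioms.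

**The `k`-pair design** (K23 floor law, `δ = 2`, no twist): `M = e_T` for the pair tableau `T` of `(2N-2k,2k)` (part L); colouring
`g = (0,1,0,1,…,0,1,0,…)` (`k` ones, at the odd slots `< 2k`); block structure `e`: position `p ↦ (X(p) mod 2, ⌊X(p)/2⌋)` with
`X = ∏_{j<k} (4j+2  4j+3)`, i.e. core columns `[(0,s_{2j}),(1,s_{2j})] ‖ [(1,s_{2j+1}),(0,s_{2j+1})]`.

**Claim** (`twoRow_value_eq_one`).  For every `σ`, `e_T(g ∘ w_σ) ∈ {0, 1}`.  Proof: by the support lemma the letters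
`A_j, B_j ‖ B'_j, A'_j` of pair `j` are bits with `A_j + B_j = 1 = B'_j + A'_j`; counting the colour `1` in block `0` gives
`Σ_j (A_j + A'_j) = k`, so (`antiPairs_card_even`) the set of anti-twin pairs (`B'_j ≠ A_j`) has even size; the product `q` of the
transpositions `(4j+2 4j+3)` over the anti-twin pairs is an EVEN column permutation with `(g ∘ w_σ) ∘ q` a twin word, whence
`e_T(g ∘ w_σ) = sgn(q) · e_T((g ∘ w_σ) ∘ q) = 1` (`twoRowTableau_twin_eq_one`).

[cite: BurgisserIkenmeyer2011, §3.4 (Prop. 3.4), Thm. 4.4] [cite: BurgisserIkenmeyer2017, §5, Thm. 5.9 (proof of (2)), eq. (3.4)]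
-/

noncomputable section

open scoped BigOperators

namespace Summit.MatrixMultiplication.MatrixMultiplication.Theorems.ObstructionCalculus

open Literature.Computability.AlgebraicComplexity
open Literature.NumberTheory.DiophantineGeometry

set_option maxHeartbeats 400000 in
/-- **A term of the `k`-pair design has `e_T(g ∘ w_σ) ∈ {0, 1}`.** [cite: BurgisserIkenmeyer2011, Thm. 4.4]
[cite: BurgisserIkenmeyer2017, Thm. 5.9 (proof of (2))] -/
theorem twoRow_value_eq_one {N k : ℕ} (hN : 2 * k ≤ N) {Y : YoungDiagram}
    (hNY : ∀ x ∈ Y.cells, x.1 < N) (T : StdFilling (N * 2) Y)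
    (hT : ∀ p : Fin (N * 2), T.1 p = (if (p : ℕ) < 4 * k then ((p : ℕ) % 2, (p : ℕ) / 2) else (0, (p : ℕ) - 2 * k)))
    (e : Fin (N * 2) ≃ Fin 2 × Fin N) (g : Fin N → Fin N)
    (hgv : ∀ i : Fin N, ((g i : Fin N) : ℕ) = if ((i : ℕ) < 2 * k ∧ (i : ℕ) % 2 = 1) then 1 else 0)
    (hpos : ∀ (σ : Fin 2 → Equiv.Perm (Fin N)) (n : ℕ) (hn : n < N * 2) (a : Fin 2) (s : Fin N),
      (if (n < 4 * k ∧ n % 4 = 2) then n + 1 else if (n < 4 * k ∧ n % 4 = 3) then n - 1 else n) % 2 = (a : ℕ) →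
      (if (n < 4 * k ∧ n % 4 = 2) then n + 1 else if (n < 4 * k ∧ n % 4 = 3) then n - 1 else n) / 2 = (s : ℕ) →
      (g ∘ fun q => σ (e q).1 (e q).2) ⟨n, hn⟩ = g (σ a s))
    (σ : Fin 2 → Equiv.Perm (Fin N))
    (hz : T.polytabloid ℂ hNY (g ∘ fun q => σ (e q).1 (e q).2) ≠ 0) :
    T.polytabloid ℂ hNY (g ∘ fun q => σ (e q).1 (e q).2) = 1 := by
  classical
  set v := (g ∘ fun q => σ (e q).1 (e q).2) with hv
  have hcolT : ∀ q : Fin (N * 2), (T.1 q).2 =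
      if (q : ℕ) < 4 * k then (q : ℕ) / 2 else (q : ℕ) - 2 * k := fun q => by
    rw [hT]; split_ifs <;> rfl
  obtain ⟨harm, hlt, hinj⟩ := twoRowTableau_support hNY T hT hz
  -- letters as a function on `ℕ`
  by_cases hk0 : k = 0
  · -- no pairs: every word in the support is the row word
    subst hk0
    apply twoRowTableau_twin_eq_one hNY T hT (by omega) harm (fun p hp => by omega) (fun p q hp => by omega)
    intro p hp; omega
  have hNpos : 0 < N * 2 := by omega
  let P : ℕ → Fin (N * 2) := fun n => ⟨n % (N * 2), Nat.mod_lt _ hNpos⟩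
  have hP : ∀ n, n < N * 2 → ((P n : Fin (N * 2)) : ℕ) = n := fun n hn => Nat.mod_eq_of_lt hn
  let U : ℕ → ℕ := fun n => ((v (P n) : Fin N) : ℕ)
  have hU : ∀ (n : ℕ) (hn : n < N * 2), ((v ⟨n, hn⟩ : Fin N) : ℕ) = U n := by
    intro n hn
    show _ = ((v (P n) : Fin N) : ℕ)
    rw [show (⟨n, hn⟩ : Fin (N * 2)) = P n from Fin.ext (hP n hn).symm]
  have hUlt : ∀ n, U n < 2 := fun n => hlt _
  have hcol : ∀ n, n + 1 < 4 * k → n % 2 = 0 → U n ≠ U (n + 1) := by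
    intro n hn hn2 h
    have h' : v (P n) = v (P (n + 1)) := Fin.ext h
    have := hinj (P n) (P (n + 1)) (by
      rw [hcolT, hcolT, hP _ (by omega), hP _ (by omega)]
      rw [if_pos (by omega), if_pos (by omega)]
      omega) h'
    have := congrArg Fin.val this
    rw [hP _ (by omega), hP _ (by omega)] at this
    omega
  have hc0 : ∀ j < k, U (4 * j) + U (4 * j + 1) = 1 := by
    intro j hj
    have := hcol (4 * j) (by omega) (by omega)
    have := hUlt (4 * j); have := hUlt (4 * j + 1); omega
  have hc1 : ∀ j < k, U (4 * j + 2) + U (4 * j + 3) = 1 := by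
    intro j hj
    have h23 := hcol (4 * j + 2) (by omega) (by omega)
    rw [show 4 * j + 2 + 1 = 4 * j + 3 by ring] at h23
    have := hUlt (4 * j + 2); have := hUlt (4 * j + 3); omega
  have hUp : ∀ x : Fin (N * 2), ((v x : Fin N) : ℕ) = U x := fun x => hU x.1 x.2
  -- counting the colour `1` in block `0`
  have hgsum : ∑ i : Fin N, ((g i : Fin N) : ℕ) = k := sum_oddIndicator_eq hN _ hgv
  have harm0 : ∀ s : Fin N, 2 * k ≤ (s : ℕ) → ((g (σ 0 s) : Fin N) : ℕ) = 0 := by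
    intro s hs
    have h := hpos σ (2 * s) (by omega) 0 s (by split_ifs <;> omega) (by split_ifs <;> omega)
    rw [← h]; exact harm _ (by simp; omega)
  have hsum0 : ∑ s, ((g (σ 0 s) : Fin N) : ℕ) = k := by
    rw [Equiv.sum_comp (σ 0) (fun x => ((g x : Fin N) : ℕ)), hgsum]
  have hpair := sum_slots_pairs_eq hN (fun s => ((g (σ 0 s) : Fin N) : ℕ)) harm0
  have hsumA : ∑ j ∈ Finset.range k, (U (4 * j) + U (4 * j + 3)) = k := by
    refine Eq.trans (Finset.sum_congr rfl ?_) (hpair.symm.trans hsum0)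
    intro j hj
    rw [Finset.mem_range] at hj
    rw [dif_pos (by omega), dif_pos (by omega)]
    have e0 := hpos σ (4 * j) (by omega) 0 ⟨2 * j, by omega⟩ (by split_ifs <;> simp <;> omega)
      (by split_ifs <;> simp <;> omega)
    have e3 := hpos σ (4 * j + 3) (by omega) 0 ⟨2 * j + 1, by omega⟩ (by split_ifs <;> simp <;> omega)
      (by split_ifs <;> simp <;> omega)
    rw [← e0, ← e3, hU, hU]
  -- the anti-twin pairs: an even number
  have hcase : ∀ j < k, (U (4 * j + 2) = U (4 * j) ∧ U (4 * j + 3) + U (4 * j) = 1) ∨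
      (U (4 * j + 2) ≠ U (4 * j) ∧ U (4 * j + 3) = U (4 * j)) := by
    intro j hj
    have := hc0 j hj; have := hc1 j hj; have := hUlt (4 * j); have := hUlt (4 * j + 2)
    by_cases h : U (4 * j + 2) = U (4 * j)
    · left; exact ⟨h, by omega⟩
    · right; exact ⟨h, by omega⟩
  have heven := antiPairs_card_even k (fun j => U (4 * j)) (fun j => U (4 * j + 3)) (fun j => U (4 * j + 2))
    hcase hsumA
  set L := ((Finset.range k).filter (fun j => U (4 * j + 2) ≠ U (4 * j))).toList with hL
  have hLnd : L.Nodup := Finset.nodup_toList _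
  have hLmem : ∀ j, j ∈ L ↔ j < k ∧ U (4 * j + 2) ≠ U (4 * j) := by
    intro j; rw [hL, Finset.mem_toList, Finset.mem_filter, Finset.mem_range]
  have hLlen : Even L.length := by rw [hL, Finset.length_toList]; exact heven
  -- the correcting column permutation `q`
  let a : ℕ → Fin (N * 2) := fun j => P (4 * j + 2)
  let b : ℕ → Fin (N * 2) := fun j => P (4 * j + 3)
  have hav : ∀ j, j < k → ((a j : Fin (N * 2)) : ℕ) = 4 * j + 2 := fun j hj => hP _ (by omega)
  have hbv : ∀ j, j < k → ((b j : Fin (N * 2)) : ℕ) = 4 * j + 3 := fun j hj => hP _ (by omega)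
  have hLk : ∀ j ∈ L, j < k := fun j hj => ((hLmem j).1 hj).1
  have hab : ∀ i ∈ L, ∀ j ∈ L, a i ≠ b j := by
    intro i hi j hj h
    have := congrArg Fin.val h; rw [hav i (hLk i hi), hbv j (hLk j hj)] at this; omega
  have ha : ∀ i ∈ L, ∀ j ∈ L, a i = a j → i = j := by
    intro i hi j hj h
    have := congrArg Fin.val h; rw [hav i (hLk i hi), hav j (hLk j hj)] at this; omega
  have hb : ∀ i ∈ L, ∀ j ∈ L, b i = b j → i = j := by
    intro i hi j hj h
    have := congrArg Fin.val h; rw [hbv i (hLk i hi), hbv j (hLk j hj)] at this; omega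
  set q : Equiv.Perm (Fin (N * 2)) := (L.map fun j => Equiv.swap (a j) (b j)).prod with hq
  obtain ⟨hq1, hq2⟩ := swapList_apply_pair a b L hLnd hab ha hb
  have hsq : Equiv.Perm.sign q = 1 := by
    rw [hq, sign_swapList a b L (fun j hj => hab j hj j hj)]
    exact Even.neg_one_pow hLlen
  have hqfix : ∀ p : Fin (N * 2), ¬ ((p : ℕ) < 4 * k ∧ 2 ≤ (p : ℕ) % 4 ∧ (p : ℕ) / 4 ∈ L) → q p = p := by
    intro p hp
    apply hq2
    intro j hj
    have hjk := hLk j hj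
    constructor
    · intro h
      have := congrArg Fin.val h; rw [hav j hjk] at this
      exact hp ⟨by omega, by omega, by rw [show (p : ℕ) / 4 = j by omega]; exact hj⟩
    · intro h
      have := congrArg Fin.val h; rw [hbv j hjk] at this
      exact hp ⟨by omega, by omega, by rw [show (p : ℕ) / 4 = j by omega]; exact hj⟩
  have hqC : q ∈ T.colStab := by
    rw [StdFilling.mem_colStab]
    intro p
    by_cases hp : (p : ℕ) < 4 * k ∧ 2 ≤ (p : ℕ) % 4 ∧ (p : ℕ) / 4 ∈ L
    · obtain ⟨hp1, hp2, hp3⟩ := hp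
      have hjk : (p : ℕ) / 4 < k := by omega
      rcases (show (p : ℕ) % 4 = 2 ∨ (p : ℕ) % 4 = 3 by omega) with h2 | h3
      · have hpa : p = a ((p : ℕ) / 4) := Fin.ext (by rw [hav _ hjk]; omega)
        have e1 := (hq1 _ hp3).1
        rw [← hpa] at e1
        rw [e1, hcolT, hcolT, hbv _ hjk]
        rw [if_pos (by omega), if_pos hp1]
        omega
      · have hpb : p = b ((p : ℕ) / 4) := Fin.ext (by rw [hbv _ hjk]; omega)
        have e1 := (hq1 _ hp3).2
        rw [← hpb] at e1
        rw [e1, hcolT, hcolT, hav _ hjk]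
        rw [if_pos (by omega), if_pos hp1]
        omega
    · rw [hqfix p hp]
  -- `v ∘ q` is a twin word
  have htw : T.polytabloid ℂ hNY (v ∘ ⇑q) = 1 := by
    apply twoRowTableau_twin_eq_one hNY T hT (by omega)
    · intro p hp
      show ((v (q p) : Fin N) : ℕ) = 0
      rw [hqfix p (fun h => by omega)]; exact harm p hp
    · intro p hp hp'
      show ((v (q p) : Fin N) : ℕ) < 2
      exact hlt _
    · intro p p' hp hp' hp4 hp4' hdiv hpp
      have h : v (q p) = v (q p') := hpp
      rw [hqfix p (fun h => by omega), hqfix p' (fun h => by omega)] at h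
      exact hinj p p' (by rw [hcolT, hcolT, if_pos hp, if_pos hp']; omega) h
    · intro p hp hp'
      show v (q _) = v (q p)
      rw [hqfix p (fun h => by omega)]
      obtain ⟨j, hj⟩ : ∃ j : ℕ, (p : ℕ) / 4 = j := ⟨_, rfl⟩
      have hjk : j < k := by omega
      have hc0j := hc0 j hjk
      have hc1j := hc1 j hjk
      have hU0 := hUlt (4 * j)
      have hU2 := hUlt (4 * j + 2)
      apply Fin.ext
      rw [hUp p]
      by_cases hjL : j ∈ L
      · -- anti-twin pair: `q` exchanges the two cells of the odd column
        have hanti := ((hLmem j).1 hjL).2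
        rcases (show (p : ℕ) % 4 = 0 ∨ (p : ℕ) % 4 = 1 by omega) with h0 | h1
        · have hpa : (⟨(p : ℕ) + 2, by omega⟩ : Fin (N * 2)) = a j :=
            Fin.ext (by show (p : ℕ) + 2 = _; rw [hav j hjk]; omega)
          rw [hpa, (hq1 j hjL).1, show (p : ℕ) = 4 * j by omega]
          show U (4 * j + 3) = U (4 * j)
          omega
        · have hpb : (⟨(p : ℕ) + 2, by omega⟩ : Fin (N * 2)) = b j :=
            Fin.ext (by show (p : ℕ) + 2 = _; rw [hbv j hjk]; omega)
          rw [hpb, (hq1 j hjL).2, show (p : ℕ) = 4 * j + 1 by omega]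
          show U (4 * j + 2) = U (4 * j + 1)
          omega
      · -- twin pair: `q` fixes the odd column
        have htwin : U (4 * j + 2) = U (4 * j) := by
          by_contra h; exact hjL ((hLmem j).2 ⟨hjk, h⟩)
        rw [hqfix _ (fun h => hjL (by rw [show j = ((p : ℕ) + 2) / 4 by omega]; simpa using h.2.2)), hUp]
        show U ((p : ℕ) + 2) = U (p : ℕ)
        rcases (show (p : ℕ) % 4 = 0 ∨ (p : ℕ) % 4 = 1 by omega) with h0 | h1
        · rw [show (p : ℕ) + 2 = 4 * j + 2 by omega, show (p : ℕ) = 4 * j by omega]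
          exact htwin
        · rw [show (p : ℕ) + 2 = 4 * j + 3 by omega, show (p : ℕ) = 4 * j + 1 by omega]
          omega
  -- `e_T(v ∘ q) = sgn(q) · e_T(v)`
  have key := congrFun (StdFilling.wordPerm_polytabloid_of_mem_colStab (k := ℂ) hNY T hqC) v
  rw [wordPerm_apply, Pi.smul_apply, smul_eq_mul, hsq, htw] at key
  simpa using key.symm

end Summit.MatrixMultiplication.MatrixMultiplication.Theorems.ObstructionCalculus
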